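import Literature.AlgebraicGeometry.Motives.ZarhinHodgeGroupLieAlgebra
import Literature.AlgebraicGeometry.Motives.HodgeStructureProofs
import Mathlib.LinearAlgebra.Eigenspace.Basic
import HarnessLib

/-!
# The Hodge operator `Θ` is purely imaginary: `conj ∘ Θ ∘ conj = -Θ`; in odd weight it has no real eigenvector

Pure Hodge structures `H` of weight `n` on a finite-dimensional `ℚ`-space `V` (the tree's
`Motives.HodgeStructure`); `Θ` any operator on `V_ℂ` acting by `2p - n = p - q` on `V^{p,q}` (the
tree's `exists_hodgeTheta`; `Θ ∈ (Lie Hdg) ⊗ ℂ`, `mem_hodgeLieC_of_forall_piece`); `conj` the real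
structure of `V_ℂ`. Proved here:

* `conj_hodgeTheta_conj_apply` — `conj (Θ (conj x)) = -Θ x`: `Θ ∈ i · Lie Hdg(ℝ)` is purely
  imaginary (Deligne, LNM 900, I 3.2/3.4: `Θ` is the differential of `h(U(1))`, i.e. `C = exp(iπΘ/2)`
  is real; Voisin I Def. 7.4 `conj V^{p,q} = V^{q,p}`);
* `eigenvalue_of_hodgeTheta` — an eigenvalue `μ` of `Θ` (on a non-zero vector) is `2p - n` for
  some `p` (`V_ℂ = ⊕ V^{p,n-p}`);
* **`hodgeTheta_apply_ne_smul_of_conj_eq_self`** — for ODD weight `n`, no non-zero REAL vector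
  (`conj x = x`) is an eigenvector of `Θ`: `Θ x = μ x` forces `Re μ = 0` by the first point and
  `μ ∈ 2ℤ - n` odd by the second.

Use (cell `pub-hodge-ring2`, Literature lane, real-multiplication programme R2a): hypothesis (i)
"`J_σ` has no `F`-rational eigenline" (`F ⊆ ℝ`) of
`RepresentationTheory/GeneralLinear/Sl2PlacesRationalHull` for the weight-one Hodge structure
`H¹(X)` of an abelian variety, read on the real eigenblocks of a totally real `End⁰(X) = E`
(Hazama 1983 §3). Research context: a route conditional on HC_CM; this file is unconditional and
no step towards a summit statement. No definition, no named fact (D-0026); axioms standard.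

## References

* [Deligne1982HodgeCycles] P. Deligne, *Hodge cycles on abelian varieties*, LNM 900 (1982), I §3
  (3.1–3.4). [cite: Deligne1982HodgeCycles, I §3]
* [VoisinHodgeI2002] C. Voisin, *Hodge Theory and Complex Algebraic Geometry I* (2002), §7.1.1
  Def. 7.4 (`V^{q,p} = conj V^{p,q}`). [cite: VoisinHodgeI2002, §7.1.1 Def. 7.4]
* [Hazama1983] F. Hazama, Tôhoku Math. J. 35 (1983) 303–308, §3 (the application). [cite: Hazama1983, §3]
-/

noncomputable section

open scoped TensorProduct

namespace Literature.AlgebraicGeometry.Motives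

namespace HodgeStructure

universe u

variable {V : Type u} [AddCommGroup V] [Module ℚ V] {n : ℤ}

/-- **`Θ` is purely imaginary: `conj (Θ (conj x)) = -Θ x`** for every operator `Θ` acting by
`2p - n` on `V^{p,n-p}` (check on `V^{p,n-p}`, where `conj` lands in `V^{n-p,p}` with eigenvalue
`2(n-p) - n = -(2p - n)`, and use `V_ℂ = ⊕_p V^{p,n-p}`). [cite: Deligne1982HodgeCycles, I §3 (3.1–3.4)]
[cite: VoisinHodgeI2002, §7.1.1 Def. 7.4] -/
theorem conj_hodgeTheta_conj_apply (H : HodgeStructure V n) {Θ : Module.End ℂ (ℂ ⊗[ℚ] V)}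
    (hΘ : ∀ p, ∀ x ∈ H.piece p (n - p), Θ x = ((2 * p - n : ℤ) : ℂ) • x) (x : ℂ ⊗[ℚ] V) :
    conj (Θ (conj x)) = -Θ x := by
  -- the set where the identity holds is a `ℂ`-submodule containing every piece
  let W : Submodule ℂ (ℂ ⊗[ℚ] V) :=
    { carrier := {x | conj (Θ (conj x)) = -Θ x}
      zero_mem' := by simp
      add_mem' := fun {x y} hx hy => by
        simp only [Set.mem_setOf_eq] at hx hy ⊢
        rw [map_add, map_add, map_add, hx, hy, map_add, neg_add]
      smul_mem' := fun c x hx => by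
        simp only [Set.mem_setOf_eq] at hx ⊢
        rw [conj_smul, map_smul, conj_smul, hx, starRingEnd_self_apply, map_smul, smul_neg] }
  have hpiece : ∀ p, H.piece p (n - p) ≤ W := by
    intro p y hy
    change conj (Θ (conj y)) = -Θ y
    have hcy : conj y ∈ H.piece (n - p) (n - (n - p)) := by
      rw [sub_sub_cancel]
      exact H.conj_mem_piece hy
    rw [hΘ (n - p) _ hcy, conj_smul, conj_conj, hΘ p y hy, ← neg_smul]
    congr 1
    rw [map_intCast, ← Int.cast_neg]
    congr 1
    ring
  have htop : W = ⊤ := by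
    rw [eq_top_iff, ← iSup_piece_eq_top_holds H]
    exact iSup_le hpiece
  have hx : x ∈ W := by rw [htop]; exact Submodule.mem_top
  exact hx

/-- **The eigenvalues of `Θ` are the `2p - n` with `V^{p,n-p} ∋` a component**: if `Θ x = μ x`
with `x ≠ 0` then `μ = 2p - n` for some `p` (the pieces are eigenspaces and span `V_ℂ`;
eigenspaces for distinct eigenvalues are independent). [cite: Deligne1982HodgeCycles, I §3 (3.1–3.4)] -/
theorem eigenvalue_of_hodgeTheta (H : HodgeStructure V n) {Θ : Module.End ℂ (ℂ ⊗[ℚ] V)}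
    (hΘ : ∀ p, ∀ x ∈ H.piece p (n - p), Θ x = ((2 * p - n : ℤ) : ℂ) • x) {x : ℂ ⊗[ℚ] V}
    (hx0 : x ≠ 0) {μ : ℂ} (hx : Θ x = μ • x) : ∃ p : ℤ, μ = ((2 * p - n : ℤ) : ℂ) := by
  by_contra hne
  push Not at hne
  -- `x` lies in the `μ`-eigenspace, which is disjoint from the span of the other eigenspaces ⊇ ⊤
  have hxE : x ∈ Module.End.eigenspace Θ μ := Module.End.mem_eigenspace_iff.2 hx
  have hind := Module.End.eigenspaces_iSupIndep Θ
  have hdisj : Disjoint (Module.End.eigenspace Θ μ) (⨆ (ν) (_ : ν ≠ μ), Module.End.eigenspace Θ ν) :=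
    hind μ
  have htop : (⊤ : Submodule ℂ (ℂ ⊗[ℚ] V)) ≤ ⨆ (ν) (_ : ν ≠ μ), Module.End.eigenspace Θ ν := by
    rw [← iSup_piece_eq_top_holds H]
    refine iSup_le fun p => ?_
    have hp : H.piece p (n - p) ≤ Module.End.eigenspace Θ (((2 * p - n : ℤ) : ℂ)) := fun y hy =>
      Module.End.mem_eigenspace_iff.2 (hΘ p y hy)
    exact hp.trans (le_iSup₂_of_le (((2 * p - n : ℤ) : ℂ)) (fun h => hne p h.symm) le_rfl)
  have h0 : x ∈ (⊥ : Submodule ℂ (ℂ ⊗[ℚ] V)) := by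
    rw [← disjoint_iff_inf_le.1 hdisj |>.antisymm bot_le]
    exact ⟨hxE, htop Submodule.mem_top⟩
  exact hx0 ((Submodule.mem_bot ℂ).1 h0)

/-- **In odd weight, `Θ` has no real eigenvector**: if `n` is odd, `conj x = x` and `x ≠ 0`, then
`Θ x ≠ μ x` for every `μ ∈ ℂ`. (`Θ x = μ x` gives `conj`: `-Θ x = μ̄ x`, so `(μ + μ̄) x = 0` and
`Re μ = 0`; but `μ = 2p - n` is an odd integer.) For `H = H¹(X)` of an abelian variety with real
multiplication this is hypothesis (i) of `Sl2PlacesRationalHull` on every real eigenblock.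
[cite: Deligne1982HodgeCycles, I §3 (3.1–3.4)] [cite: Hazama1983, §3] -/
theorem hodgeTheta_apply_ne_smul_of_conj_eq_self (H : HodgeStructure V n) (hn : Odd n)
    {Θ : Module.End ℂ (ℂ ⊗[ℚ] V)}
    (hΘ : ∀ p, ∀ x ∈ H.piece p (n - p), Θ x = ((2 * p - n : ℤ) : ℂ) • x) {x : ℂ ⊗[ℚ] V}
    (hreal : conj x = x) (hx0 : x ≠ 0) (μ : ℂ) : Θ x ≠ μ • x := by
  intro hx
  -- `μ = 2p - n`, an odd integer
  obtain ⟨p, rfl⟩ := H.eigenvalue_of_hodgeTheta hΘ hx0 hx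
  -- conjugate: `-Θ x = conj (μ x) = μ x` (μ real), so `2 μ x = 0`
  have h1 : conj (Θ (conj x)) = -Θ x := H.conj_hodgeTheta_conj_apply hΘ x
  rw [hreal, hx, conj_smul, hreal, map_intCast] at h1
  -- h1 : μ • x = -(μ • x)
  have h2 : ((2 * (2 * p - n) : ℤ) : ℂ) • x = 0 := by
    rw [Int.cast_mul, mul_smul, Int.cast_two, two_smul]
    nth_rewrite 2 [h1]
    rw [add_neg_cancel]
  rw [smul_eq_zero] at h2
  rcases h2 with h2 | h2
  · have h3 : (2 * (2 * p - n) : ℤ) = 0 := by exact_mod_cast h2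
    obtain ⟨k, hk⟩ := hn
    omega
  · exact hx0 h2

end HodgeStructure

end Literature.AlgebraicGeometry.Motives

end
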